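import Literature.Analysis.Calculus.PlumExistenceEnclosure
import HarnessLib

/-!
# Plum's existence–enclosure closing certificate (`δ ≤ α/K − G(α)`, `K g(α) < 1`)

Topic `Literature/Computation/Certificates`; companion of `RadiiPolynomialCertificate.lean` and
`NewtonKantorovichCertificate.lean`.  Plum's abstract existence and enclosure theorem for nonlinear
(elliptic) operator equations `F(u) = 0` — S. M. Rump, *Verification methods*, Acta Numerica **19**
(2010) §16.1 (section by M. Plum), **Theorem 16.1** [Rump2010Verification] (= M. Plum, Jahresber. DMV
**110** (2008)) — is PROVED in the tree as `Literature.Analysis.Calculus.exists_zero_of_integral_majorant`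
(dual-symmetric / onto case): with `‖F(ũ)‖ ≤ δ` (16.6), `‖u‖ ≤ K‖L u‖` for `L = F'(ũ)` onto (16.7),
`‖F'(ũ + u) − F'(ũ)‖ ≤ g(‖u‖)` on the ball, `g` non-decreasing on `[0, α]` (16.8), and the two CLOSING
INEQUALITIES

> (16.14) `δ ≤ α/K − G(α)`, `G(t) := ∫₀ᵗ g(s) ds`, and (16.15) `K g(α) < 1`,

"there exists a solution `u ∈ X` of the equation `F(u) = 0` satisfying `‖u − ũ‖_X ≤ α` (16.16)"
(printed p. 425 / preprint p. 131, read on the page by the typist of `PlumExistenceEnclosure.lean`, whose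
docstring quotes it), unique in that ball, with `F'(ũ + u)` bijective and
`‖x‖ ≤ K/(1 − K g(α)) ‖F'(ũ + u) x‖` on the ball (McKenna–Pacella–Plum–Roth 2012 Thm. 3.1 (b), (c)).

A certificate for this closing carries exact rationals `δ, K, α` and exact UPPER bounds `Gα ≥ G(α)`,
`gα ≥ g(α)` (the majorant `g` is a closed-form or tabulated non-decreasing function built from embedding
constants; its value and integral at `α` are enclosed by the bound-producing layer — certnum
`ode/DESIGN-nk.md` §3, planned `cap.nk` form `plum`: "transcript lines `delta_le: δ ≤ α/K − G(α)`,
`contraction: K·g(α) < 1`").  This file types the bridge: `PlumCert`, `check : Bool`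
(`0 ≤ α`, `0 ≤ K`, `δ ≤ α/K − Gα`, `K·gα < 1`), `check_eq_true_iff`, the endpoint rule `check_mono`
(smaller `δ, Gα, gα` still pass), and `sound`: `check` ∧ the analytic hypotheses (16.6)–(16.8) with
`∫₀^α g ≤ Gα`, `g(α) ≤ gα` ⇒ the conclusions above.

## What a passing certificate does NOT certify
(16.6)–(16.8) for the client's `F` (defect bound `δ`, the inverse bound `K` of the linearization —
typically from verified eigenvalue bounds, Rump §16.2–16.3 — and the majorant `g` from Sobolev embedding
constants), onto-ness of `L` (compact or dual-symmetric case; `exists_zero_of_integral_majorant_of_symmetric`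
derives it from symmetry), and the enclosures `G(α) ≤ Gα`, `g(α) ≤ gα` themselves (interval quadrature /
evaluation — engine).  The "compact case (1)" of Thm. 16.1 without (16.15) is not typed in the tree.

## Search
`lean search 'PlumCert|integral_majorant.*check|plum.*Cert'`: nothing certificate-side; analytic side
`Calculus/PlumExistenceEnclosure.lean` (PROVED: `exists_zero_of_integral_majorant`, `eq_of_zero_of_majorant`,
`bijective_fderiv_of_majorant`, `norm_le_mul_norm_fderiv_of_majorant`, `…_of_symmetric`).
-/

open Metric Set Function

namespace Literature.Computation.Certificates

namespace PlumCertificate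

open Literature.Analysis.Calculus

/-- **Closing certificate for Plum's Theorem 16.1**: exact rationals `δ ≥ ‖F(ũ)‖`, `K` (inverse bound
of the linearization, (16.7)), the enclosure radius `α`, and exact upper bounds `Gα ≥ G(α) = ∫₀^α g`,
`gα ≥ g(α)` of the majorant's integral and value at `α`.
[cite: Rump2010Verification, §16.1 Thm. 16.1 (data of the closing (16.14), (16.15))] -/
structure PlumCert where
  /-- `δ ≥ ‖F(ũ)‖`, the defect bound (16.6). -/
  δ : ℚ
  /-- `K` with `‖u‖ ≤ K ‖F'(ũ) u‖` for all `u` (16.7). -/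
  K : ℚ
  /-- The enclosure radius `α ≥ 0`. -/
  α : ℚ
  /-- `Gα ≥ G(α) = ∫₀^α g(s) ds` (exact upper bound). -/
  Gα : ℚ
  /-- `gα ≥ g(α)` (exact upper bound). -/
  gα : ℚ

namespace PlumCert

variable (c : PlumCert)

/-- **The checker**: `0 ≤ α`, `0 ≤ K`, (16.14) `δ ≤ α/K − Gα`, (16.15) `K·gα < 1`.
[cite: Rump2010Verification, §16.1 Thm. 16.1 (16.14), (16.15)] -/
def check : Bool :=
  decide (0 ≤ c.α) && decide (0 ≤ c.K) && decide (c.δ ≤ c.α / c.K - c.Gα) && decide (c.K * c.gα < 1)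

/-- `check` unfolded to its four inequalities (the transcript lines `delta_le`, `contraction`).
[cite: Rump2010Verification, §16.1 Thm. 16.1 (16.14), (16.15), unfolded] -/
theorem check_eq_true_iff :
    c.check = true ↔ 0 ≤ c.α ∧ 0 ≤ c.K ∧ c.δ ≤ c.α / c.K - c.Gα ∧ c.K * c.gα < 1 := by
  simp only [check, Bool.and_eq_true, decide_eq_true_eq, and_assoc]

/-- **Endpoint rule**: a passing certificate still passes with smaller `δ' ≤ δ`, `Gα' ≤ Gα`, `gα' ≤ gα`
and the same `K`, `α` ((16.14) and (16.15) are monotone in `δ`, `G(α)`, `g(α)`).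
[cite: Rump2010Verification, §16.1 Thm. 16.1 ((16.14), (16.15) monotone in δ, G(α), g(α))] -/
theorem check_mono {c c' : PlumCert} (h : c.check = true) (hδ : c'.δ ≤ c.δ) (hG : c'.Gα ≤ c.Gα)
    (hg : c'.gα ≤ c.gα) (hK : c'.K = c.K) (hα : c'.α = c.α) : c'.check = true := by
  rw [check_eq_true_iff] at h ⊢
  obtain ⟨h0, h1, h2, h3⟩ := h
  refine ⟨by rw [hα]; exact h0, by rw [hK]; exact h1, by rw [hα, hK]; linarith, ?_⟩
  rw [hK]
  exact lt_of_le_of_lt (mul_le_mul_of_nonneg_left hg h1) h3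

/-- **Soundness** (Plum's Theorem 16.1 in certificate form, dual-symmetric/onto case, with the
local-uniqueness and non-degeneracy supplements).  If the certificate passes and, for the client's data —
`X`, `Y` real Banach spaces, `F` with Fréchet derivative `F'(x)` on `B̄(ũ, α)`, (16.6) `‖F(ũ)‖ ≤ δ`,
(16.7) `‖u‖ ≤ K‖F'(ũ) u‖` for all `u` with `F'(ũ)` onto, (16.8) `‖F'(ũ + u) − F'(ũ)‖ ≤ g(‖u‖)` for
`‖u‖ ≤ α` with `g` non-decreasing on `[0, α]`, and the enclosures `∫₀^α g ≤ Gα`, `g(α) ≤ gα` — then there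
is `u ∈ B̄(ũ, α)` with `F(u) = 0`, it is the only zero of `F` in `B̄(ũ, α)`, and for every `‖v‖ ≤ α` the
linearization `F'(ũ + v)` is bijective with `‖x‖ ≤ K/(1 − K·gα) ‖F'(ũ + v) x‖`.
[cite: Rump2010Verification, §16.1 Thm. 16.1 (16.14)–(16.16), certificate form; arXiv:1210.5893 Thm. 3.1 (b)(c)] -/
theorem sound (hc : c.check = true) {X Y : Type*} [NormedAddCommGroup X] [NormedSpace ℝ X]
    [CompleteSpace X] [NormedAddCommGroup Y] [NormedSpace ℝ Y] [CompleteSpace Y]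
    {F : X → Y} {F' : X → X →L[ℝ] Y} {ũ : X} {g : ℝ → ℝ}
    (hF : ∀ x ∈ closedBall ũ (c.α : ℝ), HasFDerivAt F (F' x) x)
    (hδ : ‖F ũ‖ ≤ (c.δ : ℝ)) (hK : ∀ u : X, ‖u‖ ≤ (c.K : ℝ) * ‖F' ũ u‖)
    (hL : Function.Surjective (F' ũ))
    (hg : ∀ u : X, ‖u‖ ≤ (c.α : ℝ) → ‖F' (ũ + u) - F' ũ‖ ≤ g ‖u‖)
    (hmono : MonotoneOn g (Icc 0 (c.α : ℝ)))
    (hG : ∫ s in (0 : ℝ)..(c.α : ℝ), g s ≤ (c.Gα : ℝ)) (hgα : g (c.α : ℝ) ≤ (c.gα : ℝ)) :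
    (∃ u ∈ closedBall ũ (c.α : ℝ), F u = 0 ∧ ∀ u' ∈ closedBall ũ (c.α : ℝ), F u' = 0 → u' = u) ∧
      ∀ v : X, ‖v‖ ≤ (c.α : ℝ) → Function.Bijective (F' (ũ + v)) ∧
        ∀ x : X, ‖x‖ ≤ (c.K : ℝ) / (1 - c.K * c.gα) * ‖F' (ũ + v) x‖ := by
  obtain ⟨hα0, hK0, h14, h15⟩ := c.check_eq_true_iff.1 hc
  have hα0' : (0 : ℝ) ≤ c.α := by exact_mod_cast hα0
  have hK0' : (0 : ℝ) ≤ c.K := by exact_mod_cast hK0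
  have h14' : (c.δ : ℝ) ≤ c.α / c.K - c.Gα := by exact_mod_cast h14
  have h15' : (c.K : ℝ) * c.gα < 1 := by exact_mod_cast h15
  -- the certificate's lines imply the theorem's closing inequalities for the true `G(α)`, `g(α)`
  have h₁ : (c.δ : ℝ) ≤ c.α / c.K - ∫ s in (0 : ℝ)..(c.α : ℝ), g s := by linarith
  have hKg : (c.K : ℝ) * g c.α ≤ c.K * c.gα := mul_le_mul_of_nonneg_left hgα hK0'
  have h₂ : (c.K : ℝ) * g c.α < 1 := lt_of_le_of_lt hKg h15'
  refine ⟨exists_zero_of_integral_majorant hα0' hF hδ hK hL hg hmono h₁ h₂, fun v hv => ⟨?_, ?_⟩⟩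
  · exact bijective_fderiv_of_majorant hK hL hg hmono h₂ hv
  · intro x
    have hb := norm_le_mul_norm_fderiv_of_majorant hK hg hmono h₂ hv x
    have h1g : 0 < 1 - (c.K : ℝ) * g c.α := by linarith
    have h1c : 0 < 1 - (c.K : ℝ) * c.gα := by linarith
    refine hb.trans (mul_le_mul_of_nonneg_right ?_ (norm_nonneg _))
    exact div_le_div_of_nonneg_left hK0' h1c (by linarith)

end PlumCert

/-! ## Replay on sample numbers -/

/-- A Plum certificate with `δ = 1/100`, `K = 2`, `α = 1/10`, `Gα = 1/50 ≥ G(α)`, `gα = 2/5 ≥ g(α)`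
(e.g. `g(t) = 4t`: `G(1/10) = 1/50`, `g(1/10) = 2/5`): `δ = 0.01 ≤ α/K − Gα = 0.03`, `K gα = 0.8 < 1`;
decided by the kernel. [folklore] -/
private theorem plum_example : (⟨1/100, 2, 1/10, 1/50, 2/5⟩ : PlumCert).check = true := by
  decide +kernel

end PlumCertificate

end Literature.Computation.Certificates
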